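import Summits.Ventures.Crystal3D.Theorems.StickyWulffConstantGenericWallFloorInPlaneTwinStarPair
import Summits.Ventures.Crystal3D.Theorems.StickyWulffConstantGenericWallFloorCapperRiseSharp
import HarnessLib

/-!
# Tools for the hand proof of `InPlaneTwinStarPair` (crux `GenericWallFloor`, stmt-Ventures-19480, line `WallLedgerG`)

HONEST FRAMING. Venture `Summits/Ventures/Crystal3D` (cell `crystal3d-full`), helper `--supports` the crux
`GenericWallFloor` of `route-Ventures-StickyWulffConstant`, REGISTERED line `WallLedgerG`, open stub
`stub_twoSlabAdhesion`.  Rung credit only; F-C1 not moved; NOT the crux.  Elementary inner-product lemmas for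
`inPlaneTwinStarPair_holds` (`…InPlaneTwinStarPairHolds`): the contact bound `⟪y − e, s⟫ ≤ ½`, linear independence
of two in-plane unit vectors at `−½` with the normal, the real-arithmetic endgame (`false_of_hexagon_bounds`: a unit
vector with `⟪Y,ν⟫² ≤ 3/8` and `|⟪Y,Gᵢ⟫| ≤ ½` against a hexagon triple `G₁ + G₂ + G₃ = 0` cannot exist), and the
MIRROR-ANTIPODAL PAIR lemma `twin_pair_sum` (an `F₁`-slot ball and a mirrored-slot ball of the same `ν`-sign at one
centre of a `1`-separated configuration add up to `±2√(2/3)ν`: compatibility forces the underlying slots antipodal).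
WHAT THIS IS NOT: no walk, no ledger; F-C1 not moved.
-/

noncomputable section

namespace Summit.Ventures.Crystal3D.Theorems

open Summit.Ventures.Crystal3D Finset
open Literature.MathematicalPhysics.StatisticalMechanics (fccStacking)
open scoped InnerProductSpace

/-! ### Small tools -/

/-- A contact `y` of `e` off the ball `e + s` (`‖s‖ = 1`, all in a `1`-separated `X`) has `⟪y − e, s⟫ ≤ ½`. -/
theorem inner_le_half_of_contact {X : Finset (EuclideanSpace ℝ (Fin 3))}
    (hX : ∀ p ∈ X, ∀ q ∈ X, p ≠ q → 1 ≤ dist p q) {e y s : EuclideanSpace ℝ (Fin 3)} (hs : ‖s‖ = 1)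
    (hes : e + s ∈ X) (hy : y ∈ X) (hdy : dist e y = 1) (hne : y ≠ e + s) : ⟪y - e, s⟫_ℝ ≤ 1 / 2 := by
  have h1 : 1 ≤ dist y (e + s) := hX y hy (e + s) hes hne
  rw [dist_eq_norm, show y - (e + s) = (y - e) - s by abel] at h1
  have hY : ‖y - e‖ = 1 := by rw [← dist_eq_norm, dist_comm]; exact hdy
  have h2 : 1 ≤ ‖(y - e) - s‖ ^ 2 := by nlinarith [h1, norm_nonneg ((y - e) - s)]
  rw [norm_sub_sq_real, hY, hs] at h2
  linarith

/-- Unit vectors with inner product `1` are equal. -/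
theorem eq_of_inner_eq_one' {u w : EuclideanSpace ℝ (Fin 3)} (hu : ‖u‖ = 1) (hw : ‖w‖ = 1)
    (h : ⟪u, w⟫_ℝ = 1) : u = w := by
  have h0 : ‖u - w‖ ^ 2 = 0 := by rw [norm_sub_sq_real, hu, hw, h]; ring
  rw [sq_eq_zero_iff, norm_eq_zero, sub_eq_zero] at h0; exact h0

/-- Unit vectors with inner product `−1` are opposite. -/
theorem eq_neg_of_inner_eq_neg_one'' {u w : EuclideanSpace ℝ (Fin 3)} (hu : ‖u‖ = 1) (hw : ‖w‖ = 1)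
    (h : ⟪u, w⟫_ℝ = -1) : u = -w := by
  have h0 : ‖u + w‖ ^ 2 = 0 := by rw [norm_add_sq_real, hu, hw, h]; ring
  rw [sq_eq_zero_iff, norm_eq_zero] at h0; exact eq_neg_of_add_eq_zero_left h0

/-- `F₁E₁, F₁E₂, ν` with `Eᵢ` unit in-plane at inner product `−½` are linearly independent. -/
theorem linearIndependent_inPlane_pair_normal {E₁ E₂ ν : EuclideanSpace ℝ (Fin 3)}
    (h₁ : ‖E₁‖ = 1) (h₂ : ‖E₂‖ = 1) (hν : ‖ν‖ = 1) (h₁₂ : ⟪E₁, E₂⟫_ℝ = -(1 / 2))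
    (h₁ν : ⟪E₁, ν⟫_ℝ = 0) (h₂ν : ⟪E₂, ν⟫_ℝ = 0) : LinearIndependent ℝ ![E₁, E₂, ν] := by
  have n0 : ⟪E₁, E₁⟫_ℝ = 1 := by rw [real_inner_self_eq_norm_sq, h₁, one_pow]
  have n1 : ⟪E₂, E₂⟫_ℝ = 1 := by rw [real_inner_self_eq_norm_sq, h₂, one_pow]
  have n2 : ⟪ν, ν⟫_ℝ = 1 := by rw [real_inner_self_eq_norm_sq, hν, one_pow]
  have h10 : ⟪E₂, E₁⟫_ℝ = -(1 / 2) := by rw [real_inner_comm]; exact h₁₂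
  have hν1 : ⟪ν, E₁⟫_ℝ = 0 := by rw [real_inner_comm]; exact h₁ν
  have hν2 : ⟪ν, E₂⟫_ℝ = 0 := by rw [real_inner_comm]; exact h₂ν
  rw [Fintype.linearIndependent_iff]
  intro g hg
  simp only [Fin.sum_univ_three, Matrix.cons_val_zero, Matrix.cons_val_one, Matrix.cons_val] at hg
  have e0 := congrArg (fun v => ⟪v, E₁⟫_ℝ) hg
  have e1 := congrArg (fun v => ⟪v, E₂⟫_ℝ) hg
  have e2 := congrArg (fun v => ⟪v, ν⟫_ℝ) hg
  simp only [inner_add_left, real_inner_smul_left, inner_zero_left, n0, n1, n2, h₁₂, h10, h₁ν, h₂ν, hν1, hν2] at e0 e1 e2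
  intro i
  fin_cases i
  · show g 0 = 0; linarith
  · show g 1 = 0; linarith
  · show g 2 = 0; linarith

/-- Among three distinct things containing two distinct ones there is a third. -/
theorem exists_third {α : Type*} [DecidableEq α] {w₁ w₂ w₃ p q : α} (h12 : w₁ ≠ w₂) (h13 : w₁ ≠ w₃) (h23 : w₂ ≠ w₃)
    (hp : p ∈ ({w₁, w₂, w₃} : Finset α)) (hq : q ∈ ({w₁, w₂, w₃} : Finset α)) (hpq : p ≠ q) :
    ∃ r ∈ ({w₁, w₂, w₃} : Finset α), r ≠ p ∧ r ≠ q := by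
  simp only [Finset.mem_insert, Finset.mem_singleton] at hp hq
  rcases hp with rfl | rfl | rfl <;> rcases hq with rfl | rfl | rfl <;>
    first
    | exact absurd rfl hpq
    | exact ⟨w₃, by simp, by tauto, by tauto⟩
    | exact ⟨w₂, by simp, by tauto, by tauto⟩
    | exact ⟨w₁, by simp, by tauto, by tauto⟩

/-- `|x| ≤ ½ ⇒ x·x ≤ ¼`. -/
theorem mul_self_le_quarter {x : ℝ} (h : |x| ≤ 1 / 2) : x * x ≤ 1 / 4 := by
  obtain ⟨h1, h2⟩ := abs_le.1 h
  nlinarith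

/-- `|2 s t| ≤ 1` with `s² = 2/3` ⇒ `t·t ≤ 3/8`. -/
theorem mul_self_le_of_two_sided {s t : ℝ} (hs : s * s = 2 / 3) (hup : 2 * s * t ≤ 1) (hlo : -(2 * s * t) ≤ 1) :
    t * t ≤ 3 / 8 := by
  nlinarith [hs, hup, hlo, sq_nonneg (2 * s * t)]

/-- Two vectors of squared length `1/3` have inner product at most `1/3` in absolute value. -/
theorem abs_inner_le_third {A B : EuclideanSpace ℝ (Fin 3)} (hA : ‖A‖ ^ 2 = 1 / 3) (hB : ‖B‖ ^ 2 = 1 / 3) :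
    |⟪A, B⟫_ℝ| ≤ 1 / 3 := by
  have hcs := abs_real_inner_le_norm A B
  have h0a := norm_nonneg A
  have h0b := norm_nonneg B
  nlinarith [sq_nonneg (‖A‖ - ‖B‖)]

/-- The final contradiction: a unit vector `Y` with `⟪Y,ν⟫² ≤ 3/8` and `|⟪Y, Gᵢ⟫| ≤ ½` for three in-plane unit
vectors `G₁ + G₂ + G₃ = 0` at mutual inner product `−½` does not exist (`‖Y‖² ≤ 3/8 + 1/2`). -/
theorem false_of_hexagon_bounds {Y ν G₁ G₂ G₃ : EuclideanSpace ℝ (Fin 3)} (hY : ‖Y‖ = 1) (hν : ‖ν‖ = 1)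
    (h₁ : ‖G₁‖ = 1) (h₂ : ‖G₂‖ = 1) (g12 : ⟪G₁, G₂⟫_ℝ = -(1 / 2)) (g13 : ⟪G₁, G₃⟫_ℝ = -(1 / 2))
    (g23 : ⟪G₂, G₃⟫_ℝ = -(1 / 2)) (hsum : G₁ + G₂ + G₃ = 0) (h1ν : ⟪G₁, ν⟫_ℝ = 0) (h2ν : ⟪G₂, ν⟫_ℝ = 0)
    (h3ν : ⟪G₃, ν⟫_ℝ = 0) (b1 : |⟪Y, G₁⟫_ℝ| ≤ 1 / 2) (b2 : |⟪Y, G₂⟫_ℝ| ≤ 1 / 2) (b3 : |⟪Y, G₃⟫_ℝ| ≤ 1 / 2)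
    (ht : ⟪Y, ν⟫_ℝ * ⟪Y, ν⟫_ℝ ≤ 3 / 8) : False := by
  obtain ⟨t, rfl⟩ : ∃ t : ℝ, t = ⟪Y, ν⟫_ℝ := ⟨_, rfl⟩
  obtain ⟨x₁, hx₁⟩ : ∃ x : ℝ, x = ⟪Y, G₁⟫_ℝ := ⟨_, rfl⟩
  obtain ⟨x₂, hx₂⟩ : ∃ x : ℝ, x = ⟪Y, G₂⟫_ℝ := ⟨_, rfl⟩
  obtain ⟨x₃, hx₃⟩ : ∃ x : ℝ, x = ⟪Y, G₃⟫_ℝ := ⟨_, rfl⟩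
  rw [← hx₁] at b1; rw [← hx₂] at b2; rw [← hx₃] at b3
  have hx123 : x₁ + x₂ + x₃ = 0 := by
    rw [hx₁, hx₂, hx₃, ← inner_add_right, ← inner_add_right, hsum, inner_zero_right]
  have hνν : ⟪ν, ν⟫_ℝ = 1 := by rw [real_inner_self_eq_norm_sq, hν, one_pow]
  have g11 : ⟪G₁, G₁⟫_ℝ = 1 := by rw [real_inner_self_eq_norm_sq, h₁, one_pow]
  have g22 : ⟪G₂, G₂⟫_ℝ = 1 := by rw [real_inner_self_eq_norm_sq, h₂, one_pow]
  have g21 : ⟪G₂, G₁⟫_ℝ = -(1 / 2) := by rw [real_inner_comm]; exact g12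
  have gν1 : ⟪ν, G₁⟫_ℝ = 0 := by rw [real_inner_comm]; exact h1ν
  have gν2 : ⟪ν, G₂⟫_ℝ = 0 := by rw [real_inner_comm]; exact h2ν
  have gν3 : ⟪ν, G₃⟫_ℝ = 0 := by rw [real_inner_comm]; exact h3ν
  have y1 : ⟪G₁, Y⟫_ℝ = x₁ := by rw [hx₁]; exact real_inner_comm Y G₁
  have y2 : ⟪G₂, Y⟫_ℝ = x₂ := by rw [hx₂]; exact real_inner_comm Y G₂
  have y3 : ⟪G₃, Y⟫_ℝ = x₃ := by rw [hx₃]; exact real_inner_comm Y G₃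
  have yν : ⟪ν, Y⟫_ℝ = ⟪Y, ν⟫_ℝ := real_inner_comm Y ν
  obtain ⟨P, hP⟩ : ∃ P : EuclideanSpace ℝ (Fin 3),
      P = ⟪Y, ν⟫_ℝ • ν + (2 / 3 : ℝ) • (x₁ • G₁ + x₂ • G₂ + x₃ • G₃) := ⟨_, rfl⟩
  have hind := linearIndependent_inPlane_pair_normal h₁ h₂ hν g12 h1ν h2ν
  have hPY : P - Y = 0 := by
    refine eq_zero_of_inner_eq_zero_of_indep hind ?_ ?_ ?_
    · rw [hP, inner_sub_right, inner_add_right, real_inner_smul_right, real_inner_smul_right, inner_add_right,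
        inner_add_right, real_inner_smul_right, real_inner_smul_right, real_inner_smul_right, h1ν, g11, g12, g13, y1]
      linarith
    · rw [hP, inner_sub_right, inner_add_right, real_inner_smul_right, real_inner_smul_right, inner_add_right,
        inner_add_right, real_inner_smul_right, real_inner_smul_right, real_inner_smul_right, h2ν, g21, g22, g23, y2]
      linarith
    · rw [hP, inner_sub_right, inner_add_right, real_inner_smul_right, real_inner_smul_right, inner_add_right,
        inner_add_right, real_inner_smul_right, real_inner_smul_right, real_inner_smul_right, hνν, gν1, gν2, gν3, yν]
      ring
  have hPY' : P = Y := sub_eq_zero.1 hPY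
  have hYY : ⟪Y, Y⟫_ℝ = 1 := by rw [real_inner_self_eq_norm_sq, hY, one_pow]
  have hexp : ⟪P, Y⟫_ℝ = ⟪Y, ν⟫_ℝ * ⟪Y, ν⟫_ℝ + 2 / 3 * (x₁ * x₁ + x₂ * x₂ + x₃ * x₃) := by
    rw [hP, inner_add_left, real_inner_smul_left, real_inner_smul_left, inner_add_left, inner_add_left,
      real_inner_smul_left, real_inner_smul_left, real_inner_smul_left, yν, y1, y2, y3]
  rw [hPY', hYY] at hexp
  have q1 := mul_self_le_quarter b1
  have q2 := mul_self_le_quarter b2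
  have q3 := mul_self_le_quarter b3
  linarith [hexp, ht, q1, q2, q3]

/-- The mirror-antipodal pair: an `F₁`-slot ball and an `F₂`-slot ball of the same nonzero `ν`-sign at one centre,
both in a `1`-separated configuration, add up to `±2√(2/3)ν`. -/
theorem twin_pair_sum {F₁ F₂ : EuclideanSpace ℝ (Fin 3) ≃ₗᵢ[ℝ] EuclideanSpace ℝ (Fin 3)} {ν : EuclideanSpace ℝ (Fin 3)}
    (hν : ‖ν‖ = 1) (htw : ∀ w ∈ fccSlots, ∃ l ∈ fccSlots, F₂ w = F₁ l - (2 * ⟪F₁ l, ν⟫_ℝ) • ν)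
    {X : Finset (EuclideanSpace ℝ (Fin 3))} (hX : ∀ p ∈ X, ∀ q ∈ X, p ≠ q → 1 ≤ dist p q)
    {e a c : EuclideanSpace ℝ (Fin 3)} (ha : a ∈ fccSlots) (hc : c ∈ fccSlots) (haX : e + F₁ a ∈ X) (hcX : e + F₂ c ∈ X)
    {σ : ℝ} (hσ : σ = 1 ∨ σ = -1) (haν : ⟪F₁ a, ν⟫_ℝ = σ * Real.sqrt (2 / 3)) (hcν : ⟪F₂ c, ν⟫_ℝ = σ * Real.sqrt (2 / 3)) :
    F₁ a + F₂ c = (2 * σ * Real.sqrt (2 / 3)) • ν := by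
  have h23 : Real.sqrt (2 / 3) ^ 2 = 2 / 3 := Real.sq_sqrt (by norm_num)
  have hνν : ⟪ν, ν⟫_ℝ = 1 := by rw [real_inner_self_eq_norm_sq, hν, one_pow]
  have hσ2 : σ * σ = 1 := by rcases hσ with rfl | rfl <;> norm_num
  have ha1 : ‖F₁ a‖ = 1 := by rw [LinearIsometryEquiv.norm_map, norm_eq_one_of_mem_fccSlots ha]
  have hc1 : ‖F₂ c‖ = 1 := by rw [LinearIsometryEquiv.norm_map, norm_eq_one_of_mem_fccSlots hc]
  obtain ⟨l, hl, hcl⟩ := htw c hc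
  have hlν : ⟪F₁ l, ν⟫_ℝ = -(σ * Real.sqrt (2 / 3)) := by
    have : ⟪F₂ c, ν⟫_ℝ = -⟪F₁ l, ν⟫_ℝ := by rw [hcl, inner_sub_left, real_inner_smul_left, hνν]; ring
    linarith [this.symm.trans hcν]
  have hal : ⟪F₁ a, F₂ c⟫_ℝ = ⟪a, l⟫_ℝ + 4 / 3 := by
    rw [hcl, inner_sub_right, real_inner_smul_right, LinearIsometryEquiv.inner_map_map, hlν, haν]
    nlinarith [h23, hσ2]
  -- the two balls are different (a slot at squared distance 8/3 from another is impossible) ...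
  have hne : e + F₁ a ≠ e + F₂ c := by
    intro hEq
    have h1 : ⟪F₁ a, F₂ c⟫_ℝ = 1 := by
      rw [← add_left_cancel hEq, real_inner_self_eq_norm_sq, ha1, one_pow]
    rw [hal] at h1
    rcases inner_slots_mem ha hl with h | h | h | h | h <;> rw [h] at h1 <;> norm_num at h1
  -- ... hence at distance ≥ 1: `⟪a, l⟫ ≤ −5/6`, so `⟪a, l⟫ = −1`
  have hfar : ⟪F₁ a, F₂ c⟫_ℝ ≤ 1 / 2 := by
    have h1 : 1 ≤ dist (e + F₁ a) (e + F₂ c) := hX _ haX _ hcX hne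
    rw [dist_eq_norm, show e + F₁ a - (e + F₂ c) = F₁ a - F₂ c by abel] at h1
    have h2 : (1 : ℝ) ≤ ‖F₁ a - F₂ c‖ ^ 2 := by simpa using pow_le_pow_left₀ zero_le_one h1 2
    rw [norm_sub_sq_real, ha1, hc1] at h2; linarith
  have hm1 : ⟪a, l⟫_ℝ = -1 := by
    rw [hal] at hfar
    rcases inner_slots_mem ha hl with h | h | h | h | h
    · rw [h] at hfar; norm_num at hfar
    · rw [h] at hfar; norm_num at hfar
    · rw [h] at hfar; norm_num at hfar
    · rw [h] at hfar; norm_num at hfar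
    · exact h
  have hla : l = -a := by
    have := eq_neg_of_inner_eq_neg_one'' (norm_eq_one_of_mem_fccSlots ha) (norm_eq_one_of_mem_fccSlots hl) hm1
    rw [this, neg_neg]
  rw [hcl, hla, map_neg, inner_neg_left, haν]
  module

end Summit.Ventures.Crystal3D.Theorems

end
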